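import Literature.MathematicalPhysics.QuantumFieldTheory.Balaban1983to89.B8Eq182Proof

/-!
# `Balaban1983to89.B8Eq184Proof` — T. Bałaban, *Spaces of regular gauge field configurations on a lattice and gauge
# fixing conditions*, Commun. Math. Phys. **99** (1985) 75–102 [Balaban1985RegularSpaces]: (1.81)–(1.85) p. 90 ON THE
# LATTICE — the expansion of the gauge-transformed bond variable `(U₁^{u′⁻¹})_b` to first order in `A_b` and `(Dλ)(b)`,
# PROVED on the concrete `ℤᵈ` carrier with explicit constants (file 2 of 2 for row B8.Eq1.84; file 1 = `B8Eq182Proof`)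

statement-level skeleton of published theorems with citation tags; proofs where landed; nothing here is a claim about the Yang–Mills mass gap

PDF held: `paper:balaban1985-cmp99-regular-spaces-gauge-fixing` (journal page = PDF page + 74); [3] = [Balaban1985Averaging]
`paper:balaban1985-cmp98-averaging` (journal page = PDF page + 16).  READ AS IMAGES for this module (renders
`run/shared/lean/pub/pub-balaban/b2b-balaban-ref1/pages/…-x2.png`): B8 pp. 76, 78, 88, 89, 90 [PDF 2, 4, 14, 15, 16].

WHAT IS REPRODUCED.  SKELETON row **B8.Eq1.84** ((1.80)–(1.85) p. 90; cell `lit-balaban`, Phase 2, seat p05 gen 2,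
referee ref-4, owner r05; HOME `run/shared/lean/pub/lit-balaban/`, seat dir `lit-balaban-p05/`).  Until now the row was
typed only through the ABSTRACT remainder of `B8SectDSource` (a map `Φ` with sup/Lipschitz hypotheses); this file proves
the displays (1.81)–(1.85) themselves for the lineage's concrete objects: the moving-frame gauge action (1.17) =
`B7Eq92Concrete.mgauge` ((55) of [3]), the forward covariant derivative (1.1) `D = D^η_{U₀}` = `B8Ineq132.covDerivFwd`
(spacing `η` explicit, sites `ℤᵈ`), `R(X)Y = XYX⁻¹` = `conjR`/`Rc`, `log` = the series (21) of [3] = `MatrixLog.mlog`, in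
an arbitrary complete normed `ℂ`-algebra `𝔸` with `‖1‖ = 1`.  The algebraic expansions ((1.82)–(1.85) for elements
`X, Y, a`, from [3] (41)/(31)) and the printed remainder functions `𝔉₁ = frakF1`, `𝔉₂ = frakF2` with their bounds
(1.83) `norm_frakF1_le`, (1.85) `norm_frakF2_le` are file 1, `B8Eq182Proof` (`W182`, `gAd` = print's `g(i ad_Y)X`,
`F183`, `F185`); (1.80) (the equation `RD*(1/iη) log U₁^{u′⁻¹} = 0`) states the problem and is not a theorem.

THE PRINTED TEXT (p. 90 [PDF 16], verbatim).  *"We get a second equation for λ using (1.38): RD*(1/iη) log U₁^{u′⁻¹} = 0.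
(1.80)  We have (U₁^{u′⁻¹})_b = u′⁻¹(b₋)U_{1,b}R_{0,b}u′(b₊) = e^{iηR(u′⁻¹(b₋))A_b}e^{−iλ(b₋)}e^{iR_{0,b}λ(b₊)} =
e^{iηR(u′⁻¹(b₋))A_b}e^{−iλ(b₋)}e^{iλ(b₋)+iη(Dλ)(b)}, (1.81) and using the formulas (32), (36)–(41) [3] we obtain
(U₁^{u′⁻¹})_b = e^{iηR(u′⁻¹(b₋))A_b}e^{iηg(i ad_{λ(b₋)})(Dλ)(b)+iη²𝔉₁(λ(b₋),(Dλ)(b))}, (1.82) where the Lie algebra valued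
function 𝔉₁ satisfies the bound |𝔉₁(λ(b₋), (Dλ)(b))| ≦ O(1)|(Dλ)(b)|². (1.83)  We assume of course that α₄ is sufficiently
small. Using (28) and (31) [3], we get (1/iη) log(U₁^{u′⁻¹})_b = R(u′⁻¹(b₋))A_b + g(i ad_{λ(b₋)})(Dλ)(b) +
η𝔉₂(λ(b₋), (Dλ)(b), A_b), (1.84) where |𝔉₂(λ(b₋), (Dλ)(b), A_b)| ≦ O(1)|A_b||(Dλ)(b)|. (1.85)  Now we apply the derivative
D* to the expression on the right-hand side of (1.84). ηD* is a bounded operator, hence D*η𝔉₁ satisfies the bound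
(1.85)."*  Context (p. 89 [PDF 15]): *"We fix a configuration U₀ and we omit it in formulas below, for example we write D
instead of D^η_{U₀}."*; (1.69) p. 88 [PDF 14]: *"U₁ = U′^{u₁⁻¹} = e^{iηA}"*; (1.77) p. 90: *"|λ| < α₄, |(Dλ)(b)| < α₄(Lʲη)⁻¹
for b ∈ Ω_j … where α₄ is sufficiently small"*; (1.17) p. 78 [PDF 4]: *"U′^u(x, x′) = u(x)U′(x, x′)R(U₀(x, x′))u⁻¹(x′).
(1.17)"*; (1.1) p. 76 [PDF 2]: *"(D^η_{U,μ}F)(x) = η⁻¹(R(U(x, x + ηe_μ))F(x + ηe_μ) − F(x))"*.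

DICTIONARY print ↦ Lean (conventions of the b07/b08 lineage: sites `Site d = ℤᵈ`, the lattice spacing carried by the
explicit real `η` of `covDerivFwd`; a bond `b = ⟨x, x + ηe_μ⟩ ↦ (x, μ)`, `b₋ = x`, `b₊ = x + e μ`; `i ↦ Complex.I`).
`λ` ↦ `lam : Site d → 𝔸`; `u′ = e^{iλ}` ↦ `gaugeExp lam` (`x ↦ expUnit (I • lam x)`); `U₁ = e^{iηA}` ↦ `cfgExp η A`
(`(x, μ) ↦ expUnit (I • (η • A x μ))`); the background `U₀ : Site d → Fin d → 𝔸ˣ`; `U₁^{u′⁻¹}` (the action (1.17) by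
`u′⁻¹`) ↦ `mgauge U₀ (fun y => (gaugeExp lam y)⁻¹) (cfgExp η A)`; `R_{0,b} = R(U₀(b))` ↦ `Rc (U₀ x μ)` (on units) /
`conjR (U₀ x μ)` (on `𝔸`); `(Dλ)(b)` ↦ `covDerivFwd η U₀ μ lam x`; `(1/iη) log` ↦ `η⁻¹ • (I⁻¹ : ℂ) • mlog`;
`g(i ad_{λ(b₋)})(Dλ)(b)` ↦ `gAd ((Dλ)(b)) (λ(b₋))`, `𝔉₁` ↦ `frakF1 η (λ(b₋)) ((Dλ)(b))`, `𝔉₂` ↦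
`frakF2 η (λ(b₋)) ((Dλ)(b)) A_b` (file 1; explicit functions of exactly the printed arguments and `η`).

WHAT THIS FILE PROVES (kernel-checked, 0 sorry, axioms standard; the ONLY hypotheses are `η > 0` and the displayed
smallness `|λ(b₋)| ≤ 1/12`, `η|(Dλ)(b)| ≤ 1/70` (`< 1/3` for (1.82)–(1.83)), `η|A_b| ≤ 1/12` — print's "α₄ sufficiently
small" of (1.77), and (1.69) with `B₁(α₀ + α₁)` small): **`eq181_first`**, **`eq181`** — (1.81) as EXACT identities of
units for every `η ≠ 0`, `U₀`, `λ`, `A` and bond (`conjR_eq_add_eta_smul_covDerivFwd` = the step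
`R_{0,b}λ(b₊) = λ(b₋) + η(Dλ)(b)`); **`eq182`** — (1.82) as an identity of units; **`eq184`** — (1.84); and
**`eq184_printed`** — (1.84) together with (1.83) `|𝔉₁| ≤ 41|(Dλ)(b)|²` and (1.85) `|𝔉₂| ≤ 17|A_b||(Dλ)(b)|` (file 1's
`norm_frakF1_le`, `norm_frakF2_le` at the lattice arguments).
READING RECORDED (not silently repaired).  The display (1.84) prints no `η𝔉₁` term, while (1.82) produces one and the
sentence after (1.85) keeps it ("hence D*η𝔉₁ satisfies the bound (1.85)"); `𝔉₁` is `A`-free and generically non-zero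
(third-order BCH term — the audit cell `pub-balaban` records this as GAPS G-B8-11(a), "constants only; repair stated"),
so it cannot be absorbed into a function bounded by `O(1)|A_b||(Dλ)(b)|`.  This file proves (1.84) in the form
`(1/iη) log(U₁^{u′⁻¹})_b = R(u′⁻¹(b₋))A_b + g(i ad_{λ(b₋)})(Dλ)(b) + η𝔉₁ + η𝔉₂` with BOTH printed bounds (1.83), (1.85) —
the display with its elided term restored, which is how the text itself uses it; no refutation witness is filed.
Constants `41`, `17` are ADMISSIBLE values on the stated polydisc in any complete normed algebra (print: unspecified
`O(1)`); they contain the conjugation factor `e^{2|λ(b₋)|} ≤ 6/5`, equal to `1` for unitary `u′`.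
NOT DONE HERE.  (1.80); (1.86)–(1.89) (row B8.Eq1.87; `B8Eq186AdCommutator` of the audit cell proves (1.86)–(1.87)).
-/

noncomputable section

open NormedSpace Set Filter Topology Metric
open Complex (I I_ne_zero)

namespace Literature.MathematicalPhysics.QuantumFieldTheory.Balaban1983to89.B8Eq184Proof

open MatrixLog B7BlockAvgLog B7Eq38Remainder B8Eq182Proof
open B7Prop1Explicit (e expUnit val_expUnit val_inv_expUnit)
open B7Eq78Linearization (conjR conjR_apply conjR_add conjR_sub conjR_smul conjR_smul_real conjR_one)
open B7Eq92Concrete (Rc Rc_apply mgauge mgauge_apply expUnit_conj)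
open B8Ineq132 (covDerivFwd)

export B7Prop1Explicit (Site) -- the `ℤ^d` sites of the b07 lineage (not the torus sites of `Setup.lean`)

variable {d : ℕ}
variable {𝔸 : Type*} [NormedRing 𝔸] [NormedAlgebra ℂ 𝔸] [NormOneClass 𝔸] [CompleteSpace 𝔸]

/-! ## The lattice displays: (1.81) exactly, then (1.82)–(1.85) at the bond `b = ⟨x, x + ηe_μ⟩` -/

/-- **`u′ = e^{iλ}`** (p. 90, before (1.77): *"the set of configurations u′ = e^{iλ}"*), as a unit-valued gauge function
on `ℤᵈ`. [cite: Balaban1985RegularSpaces, (1.77) p.90] -/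
def gaugeExp (lam : Site d → 𝔸) (x : Site d) : 𝔸ˣ := expUnit (I • lam x)

/-- **`U₁ = e^{iηA}`** ((1.69) p. 88), as a unit-valued bond configuration on `ℤᵈ` (`A x μ = A_{⟨x, x+ηe_μ⟩}`).
[cite: Balaban1985RegularSpaces, (1.69) p.88] -/
def cfgExp (η : ℝ) (A : Site d → Fin d → 𝔸) (x : Site d) (μ : Fin d) : 𝔸ˣ := expUnit (I • (η • A x μ))

omit [NormOneClass 𝔸] [CompleteSpace 𝔸] in
/-- The forward covariant derivative (1.1) solved for the transported value: `R(U₀(b))λ(b₊) = λ(b₋) + η(Dλ)(b)` (the step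
between the two lines of (1.81)). [cite: Balaban1985RegularSpaces, (1.1) p.76, (1.81) p.90] -/
theorem conjR_eq_add_eta_smul_covDerivFwd {η : ℝ} (hη : η ≠ 0) (U₀ : Site d → Fin d → 𝔸ˣ) (μ : Fin d)
    (lam : Site d → 𝔸) (x : Site d) :
    conjR (U₀ x μ) (lam (x + e μ)) = lam x + η • covDerivFwd η U₀ μ lam x := by
  rw [covDerivFwd, smul_smul, mul_inv_cancel₀ hη, one_smul, add_sub_cancel]

omit [NormOneClass 𝔸] in
/-- **(1.81), first equality** — (1.17) at the gauge function `u′⁻¹`: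
`(U₁^{u′⁻¹})_b = u′⁻¹(b₋)U_{1,b}R_{0,b}u′(b₊)`, for EVERY `U₀`, `λ`, `A`, `η` (definitional for `mgauge`, with
`R_{0,b}(u′(b₊)⁻¹)⁻¹ = R_{0,b}u′(b₊)`). [cite: Balaban1985RegularSpaces, (1.81) p.90, (1.17) p.78] -/
theorem eq181_first (η : ℝ) (U₀ : Site d → Fin d → 𝔸ˣ) (lam : Site d → 𝔸) (A : Site d → Fin d → 𝔸)
    (x : Site d) (μ : Fin d) :
    mgauge U₀ (fun y => (gaugeExp lam y)⁻¹) (cfgExp η A) x μ =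
      (gaugeExp lam x)⁻¹ * cfgExp η A x μ * Rc (U₀ x μ) (gaugeExp lam (x + e μ)) := by
  simp only [mgauge_apply, map_inv, inv_inv]

omit [NormOneClass 𝔸] in
/-- **(1.81)** (both remaining equalities): for every `η ≠ 0`, background `U₀`, `λ`, `A` and bond `b = ⟨x, x + ηe_μ⟩`,
`(U₁^{u′⁻¹})_b = e^{iηR(u′⁻¹(b₋))A_b}·e^{−iλ(b₋)}·e^{iλ(b₋)+iη(Dλ)(b)}` EXACTLY, as units of `𝔸` (`u′ = e^{iλ}`,
`U₁ = e^{iηA}`, `D = D^η_{U₀}`; the middle expression `e^{iR_{0,b}λ(b₊)}` of print is the last factor by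
`conjR_eq_add_eta_smul_covDerivFwd`). [cite: Balaban1985RegularSpaces, (1.81) p.90] -/
theorem eq181 {η : ℝ} (hη : η ≠ 0) (U₀ : Site d → Fin d → 𝔸ˣ) (lam : Site d → 𝔸) (A : Site d → Fin d → 𝔸)
    (x : Site d) (μ : Fin d) :
    mgauge U₀ (fun y => (gaugeExp lam y)⁻¹) (cfgExp η A) x μ =
      expUnit (I • (η • conjR (gaugeExp lam x)⁻¹ (A x μ))) * expUnit (-(I • lam x)) *
        expUnit (I • lam x + I • (η • covDerivFwd η U₀ μ lam x)) := by
  rw [eq181_first]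
  -- the last factor: `R_{0,b}u′(b₊) = e^{iR_{0,b}λ(b₊)} = e^{iλ(b₋)+iη(Dλ)(b)}`
  have h3 : Rc (U₀ x μ) (gaugeExp lam (x + e μ)) = expUnit (I • lam x + I • (η • covDerivFwd η U₀ μ lam x)) := by
    rw [gaugeExp, ← expUnit_conj, ← smul_add, ← conjR_eq_add_eta_smul_covDerivFwd hη U₀ μ lam x, ← conjR_smul,
      conjR_apply]
  -- the first two factors: `u′⁻¹(b₋)e^{iηA_b} = e^{iηR(u′⁻¹(b₋))A_b}u′⁻¹(b₋)`
  have h1 : (gaugeExp lam x)⁻¹ * cfgExp η A x μ =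
      expUnit (I • (η • conjR (gaugeExp lam x)⁻¹ (A x μ))) * (gaugeExp lam x)⁻¹ := by
    have hc := expUnit_conj (gaugeExp lam x)⁻¹ (I • (η • A x μ))
    rw [Rc_apply] at hc
    rw [cfgExp, ← conjR_smul_real, ← conjR_smul, conjR_apply, hc, inv_mul_cancel_right]
  rw [h1, h3, gaugeExp, val_inv_expUnit]

omit [NormOneClass 𝔸] in
/-- **(1.82)–(1.83) on the lattice**: for `η > 0`, `|λ(b₋)| ≤ 1/12`, `η|(Dλ)(b)| < 1/3`,
`e^{−iλ(b₋)}e^{iλ(b₋)+iη(Dλ)(b)} = exp[iηg(i ad_{λ(b₋)})(Dλ)(b) + iη²𝔉₁(λ(b₋), (Dλ)(b))]` as units of `𝔸`.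
[cite: Balaban1985RegularSpaces, (1.82) p.90] -/
theorem eq182 {η : ℝ} (hη : 0 < η) (U₀ : Site d → Fin d → 𝔸ˣ) (μ : Fin d) {lam : Site d → 𝔸} {x : Site d}
    (hl : ‖lam x‖ ≤ 1 / 12) (hD : η * ‖covDerivFwd η U₀ μ lam x‖ < 1 / 3) :
    expUnit (-(I • lam x)) * expUnit (I • lam x + I • (η • covDerivFwd η U₀ μ lam x)) =
      expUnit (I • (η • gAd (covDerivFwd η U₀ μ lam x) (lam x) +
        η ^ 2 • frakF1 η (lam x) (covDerivFwd η U₀ μ lam x))) := by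
  have hX : ‖(η • covDerivFwd η U₀ μ lam x : 𝔸)‖ < 1 / 3 := by
    rwa [norm_smul, Real.norm_eq_abs, abs_of_pos hη]
  have hη2 : (η ^ 2 : ℝ) ≠ 0 := pow_ne_zero 2 hη.ne'
  have hW : W182 (η • covDerivFwd η U₀ μ lam x) (lam x) =
      η • gAd (covDerivFwd η U₀ μ lam x) (lam x) + η ^ 2 • frakF1 η (lam x) (covDerivFwd η U₀ μ lam x) := by
    rw [eq182_alg hX hl, gAd_smul_real η _ hl, frakF1, smul_smul, mul_inv_cancel₀ hη2, one_smul]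
  apply Units.ext
  rw [Units.val_mul, val_expUnit, val_expUnit, val_expUnit, ← hW, exp_I_W182 hX.le hl]

omit [NormOneClass 𝔸] in
/-- **(1.84) on the lattice** (with the `η𝔉₁` term of (1.82) kept — see the module docstring): for `η > 0`,
`|λ(b₋)| ≤ 1/12`, `η|(Dλ)(b)| ≤ 1/70` (the identity itself needs no condition on `A_b`; the bound (1.85) does),
`(1/iη) log(U₁^{u′⁻¹})_b = R(u′⁻¹(b₋))A_b + g(i ad_{λ(b₋)})(Dλ)(b) + η𝔉₁(λ(b₋), (Dλ)(b)) + η𝔉₂(λ(b₋), (Dλ)(b), A_b)`,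
`log` = the series (21) of [3] applied to the unit `(U₁^{u′⁻¹})_b` of (1.81). [cite: Balaban1985RegularSpaces, (1.84) p.90] -/
theorem eq184 {η : ℝ} (hη : 0 < η) (U₀ : Site d → Fin d → 𝔸ˣ) {lam : Site d → 𝔸} (A : Site d → Fin d → 𝔸)
    {x : Site d} (μ : Fin d) (hl : ‖lam x‖ ≤ 1 / 12) (hD : η * ‖covDerivFwd η U₀ μ lam x‖ ≤ 1 / 70) :
    η⁻¹ • ((I⁻¹ : ℂ) • mlog ((mgauge U₀ (fun y => (gaugeExp lam y)⁻¹) (cfgExp η A) x μ : 𝔸ˣ) : 𝔸)) =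
      conjR (gaugeExp lam x)⁻¹ (A x μ) + gAd (covDerivFwd η U₀ μ lam x) (lam x) +
        η • frakF1 η (lam x) (covDerivFwd η U₀ μ lam x) +
        η • frakF2 η (lam x) (covDerivFwd η U₀ μ lam x) (A x μ) := by
  have hX : ‖(η • covDerivFwd η U₀ μ lam x : 𝔸)‖ < 1 / 3 := by
    rw [norm_smul, Real.norm_eq_abs, abs_of_pos hη]; linarith
  have hη0 : η ≠ 0 := hη.ne'
  have hcoef : η * (η ^ 2)⁻¹ = η⁻¹ := by
    rw [pow_two, mul_inv, ← mul_assoc, mul_inv_cancel₀ hη0, one_mul]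
  rw [eq181 hη0, Units.val_mul, Units.val_mul, val_expUnit, val_expUnit, val_expUnit, mul_assoc,
    eq184_alg hX hl]
  simp only [gaugeExp, val_inv_expUnit]
  rw [gAd_smul_real η _ hl, frakF1, frakF2]
  simp only [smul_add, smul_smul, inv_mul_cancel₀ hη0, one_smul, hcoef]

/-- **(1.81)–(1.85) assembled as printed** (row B8.Eq1.84): under `η > 0`, `|λ(b₋)| ≤ 1/12`, `η|(Dλ)(b)| ≤ 1/70`,
`η|A_b| ≤ 1/12`, the expansion (1.84) of `(1/iη) log(U₁^{u′⁻¹})_b` holds with remainders obeying (1.83)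
`|𝔉₁| ≤ 41|(Dλ)(b)|²` and (1.85) `|𝔉₂| ≤ 17|A_b||(Dλ)(b)|`. [cite: Balaban1985RegularSpaces, (1.81)–(1.85) p.90] -/
theorem eq184_printed {η : ℝ} (hη : 0 < η) (U₀ : Site d → Fin d → 𝔸ˣ) {lam : Site d → 𝔸}
    (A : Site d → Fin d → 𝔸) {x : Site d} (μ : Fin d) (hl : ‖lam x‖ ≤ 1 / 12)
    (hD : η * ‖covDerivFwd η U₀ μ lam x‖ ≤ 1 / 70) (hA : η * ‖A x μ‖ ≤ 1 / 12) :
    η⁻¹ • ((I⁻¹ : ℂ) • mlog ((mgauge U₀ (fun y => (gaugeExp lam y)⁻¹) (cfgExp η A) x μ : 𝔸ˣ) : 𝔸)) =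
        conjR (gaugeExp lam x)⁻¹ (A x μ) + gAd (covDerivFwd η U₀ μ lam x) (lam x) +
          η • frakF1 η (lam x) (covDerivFwd η U₀ μ lam x) +
          η • frakF2 η (lam x) (covDerivFwd η U₀ μ lam x) (A x μ) ∧
      ‖frakF1 η (lam x) (covDerivFwd η U₀ μ lam x)‖ ≤ 41 * ‖covDerivFwd η U₀ μ lam x‖ ^ 2 ∧
      ‖frakF2 η (lam x) (covDerivFwd η U₀ μ lam x) (A x μ)‖ ≤
        17 * ‖A x μ‖ * ‖covDerivFwd η U₀ μ lam x‖ :=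
  ⟨eq184 hη U₀ A μ hl hD, norm_frakF1_le hη hl (by linarith), norm_frakF2_le hη hl hD hA⟩


end Literature.MathematicalPhysics.QuantumFieldTheory.Balaban1983to89.B8Eq184Proof
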